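import Literature.NumberTheory.LFunctions.RodgersTaoTruncHamiltonianBoundProofs
import Literature.NumberTheory.LFunctions.RodgersTaoTruncHamiltonianExpansionProofs
import Literature.NumberTheory.LFunctions.RodgersTaoLocationUniformProofs
import Mathlib.MeasureTheory.Integral.IntervalIntegral.AbsolutelyContinuousFun
import HarnessLib

/-!
# Rodgers–Tao 2020, Theorem 17 (= arXiv v4 Thm. 7.2) from Proposition 22 and Corollary 25 — CONTENT TWIN of the closing paragraph of §7

RH-FREE CONTENT (0 defs / 0 named facts). Rodgers–Tao, *The de Bruijn–Newman constant is
non-negative*, Forum Math. Pi 8 (2020) e6, §7. The section proves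

> «**Theorem 17.** For any `T > 0`, one has
> `∫_{Λ/4}^0 Ẽ^{[0.5 T log T, 3T log T]_{ℤ*}}(t) dt = o_{T→∞}(T log³₊ T)`.» (65)

by the reduction (p. 42) «Since the `E_{jk}` are non-negative, we see from (66) that to prove (65) it
will suffice to show that `∫_{Λ/4}^0 Ẽ_T(t) dt = o_{T→∞}(T log³₊ T)` (68)» and the closing paragraph
(p. 56): «From Proposition 22 and the fundamental theorem of calculus for absolutely continuous
functions, one has `H̃_T(Λ/4) − H̃_T(0) = (4 + o_{T→∞}(1)) ∫_{Λ/4}^0 Ẽ_T(t) dt + o_{T→∞}(T log³₊ T)` and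
the claim (68) now follows from Corollary 25. This concludes the proof of Theorem 17.»

This module formalises exactly these two steps, over the tree shapes of Proposition 22
(`rodgers_tao_truncHamiltonian_deriv`) and Corollary 25 (`rodgers_tao_truncHamiltonian_bound`):

* `RodgersTaoIntegratedEnergyBound.truncWeight_ge_of_le` — (66): `ψ_T(j) ≥ 4^{−100}` for
  `|j| ≤ 3 T log T`;
* `RodgersTaoIntegratedEnergyBound.renormEnergyOn_le_truncEnergy` — the reduction (65) ⇐ (68) at a
  fixed time: `Ẽ^{[½T log T, 3T log T]}(t) ≤ 4^{200} Ẽ_T(t)` whenever `Ẽ_T(t)` is finite («since the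
  `E_{jk}` are non-negative, we see from (66) …»);
* `rodgers_tao_integrated_energy_bound_of` — the SCHEMA at a fixed `t₀ < 0` with `H_{t₀}` real-rooted:
  the inner shapes of Proposition 22 and Corollary 25 imply the inner shape of Theorem 17
  (`rodgers_tao_integrated_energy_bound`), by the fundamental theorem of calculus for the absolutely
  continuous `H̃_T` on `[t₀/4, 0]` (the `o(Ẽ_T)` error of (76) is absorbed using `ε ≤ 1`, leaving
  `3 Ẽ_T ≤ −∂ₜH̃_T + ε T log³ T` almost everywhere);
* `rodgers_tao_integrated_energy_bound_of_facts` — the AS-PRINTED reduction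
  `rodgers_tao_truncHamiltonian_deriv → rodgers_tao_truncHamiltonian_bound →
  rodgers_tao_integrated_energy_bound`;
* `rodgers_tao_integrated_energy_bound_of_expansion_deriv_lowerBound` — composed with the
  as-printed reduction of Corollary 25 (`rodgers_tao_truncHamiltonian_bound_of_facts`, module
  `RodgersTaoTruncHamiltonianBoundProofs`): Lemma 19, Proposition 22 and Lemma 24 in their tree
  shapes imply Theorem 17 in its tree shape;
* `rodgers_tao_truncHamiltonian_bound_of_deriv_lowerBound`,
  `rodgers_tao_integrated_energy_bound_of_deriv_lowerBound` — the same with the Lemma 19 input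
  DISCHARGED by the tree's content theorems (`rodgers_tao_truncHamiltonian_expansion_of_cor33_location`,
  module `RodgersTaoTruncHamiltonianExpansionProofs`, fed with `RodgersTao2020.cor33_location_content`,
  module `RodgersTaoLocationUniformProofs`): Proposition 22 and Lemma 24 in their tree shapes imply
  Corollary 25 and Theorem 17 in theirs.

LABEL: RH-FREE; bears_on N-C/N-P (COLUMN 3, de Bruijn–Newman side). WHAT THIS IS NOT: not a proof
of Proposition 22 or Corollary 25 (hypotheses, in their tree shapes); nothing here bears on the
truth of RH.

## References
* [RodgersTaoFMP2020] B. Rodgers, T. Tao, *The de Bruijn–Newman constant is non-negative*, Forum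
  Math. Pi 8 (2020), e6 — Thm. 17 p. 42 (65)–(68), Prop. 22 p. 48 (76), Cor. 25 p. 56 and the
  closing paragraph of §7 p. 56 (= arXiv:1801.05914v4 Thm. 7.2, Prop. 7.7, Cor. 7.10).
-/

noncomputable section

open Real Set Filter Topology MeasureTheory

namespace Literature.NumberTheory.LFunctions

namespace RodgersTaoIntegratedEnergyBound

/-! ## (66): the weight is bounded below on the window -/

/-- From (66): for `T log T > 0` and `|j| ≤ 3 T log T` one has `ψ_T(j) ≥ 4^{−100}` («we see from
(66) that to prove (65) it will suffice to show (68)»). [cite: RodgersTaoFMP2020, §7 p. 42 (66)] -/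
theorem truncWeight_ge_of_le {T : ℝ} (hT : 0 < T * Real.log T) {j : ℤ}
    (hj : |(j : ℝ)| ≤ 3 * (T * Real.log T)) : (4 ^ 100 : ℝ)⁻¹ ≤ truncWeight T j := by
  rw [truncWeight_eq]
  have h0 : 0 ≤ |(j : ℝ)| / (T * Real.log T) := by positivity
  have h1 : 1 + |(j : ℝ)| / (T * Real.log T) ≤ 4 := by
    have : |(j : ℝ)| / (T * Real.log T) ≤ 3 := by
      rw [div_le_iff₀ hT]
      linarith
    linarith
  have h2 : (1 + |(j : ℝ)| / (T * Real.log T)) ^ 100 ≤ 4 ^ 100 :=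
    pow_le_pow_left₀ (by linarith) h1 100
  exact inv_anti₀ (by positivity) h2

/-! ## (65) ⇐ (68) at a fixed time -/

/-- The reduction of (65) to (68) at a fixed time `t > Λ` («Since the `E_{jk}` are non-negative, we
see from (66) that to prove (65) it will suffice to show (68)»): when `Ẽ_T(t)` is finite and
`T ≥ 3`, `Ẽ^{[½ T log T, 3 T log T]}(t) ≤ 4^{200} Ẽ_T(t)`.
[cite: RodgersTaoFMP2020, §7 p. 42 (65)–(68)] -/
theorem renormEnergyOn_le_truncEnergy {T t : ℝ} (hT : 3 ≤ T)
    (hΛ : ∃ t₁ : ℝ, t₁ < t ∧ HasOnlyRealZeros (deBruijnH t₁))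
    (hsum : Summable (truncEnergyTerm T t)) :
    renormEnergyOn t (Finset.Icc ⌈T * Real.log T / 2⌉₊ ⌊3 * T * Real.log T⌋₊) ≤
      4 ^ 200 * truncEnergy T t := by
  have hlog : 0 < Real.log T := Real.log_pos (by linarith)
  have hT0 : 0 < T := by linarith
  have hTlog : 0 < T * Real.log T := mul_pos hT0 hlog
  have hmono : StrictMono (deBruijnZeroZ t) := strictMono_deBruijnZeroZ hΛ
  set I : Finset ℕ := Finset.Icc ⌈T * Real.log T / 2⌉₊ ⌊3 * T * Real.log T⌋₊ with hI
  -- indices of the window are positive and at most `3 T log T`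
  have hmemI : ∀ n ∈ I, 1 ≤ n ∧ (n : ℝ) ≤ 3 * (T * Real.log T) := by
    intro n hn
    rw [hI, Finset.mem_Icc] at hn
    refine ⟨le_trans (Nat.one_le_iff_ne_zero.2 (Nat.pos_iff_ne_zero.1
      (Nat.ceil_pos.2 (by positivity)))) hn.1, ?_⟩
    have h := (Nat.le_floor_iff (by positivity)).1 hn.2
    linarith
  -- the summand on all of `ℤ × ℤ`
  set G : ℤ × ℤ → ℝ := fun q ↦ truncWeight T q.1 * truncWeight T q.2 * renormEnergyZ t q.1 q.2
    with hG
  have hGnn : ∀ q : ℤ × ℤ, q ∈ zstarOffDiag → 0 ≤ G q := by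
    intro q hq
    exact mul_nonneg (mul_nonneg (truncWeight_pos hTlog _).le (truncWeight_pos hTlog _).le)
      (renormEnergyZ_nonneg_of_strictMono hmono hq.2.2)
  have hsumG : Summable (zstarOffDiag.indicator G) := by
    rw [← summable_subtype_iff_indicator]
    exact hsum
  have htsum : truncEnergy T t = ∑' q : ℤ × ℤ, zstarOffDiag.indicator G q := by
    rw [truncEnergy_eq, ← tsum_subtype zstarOffDiag G]
    rfl
  -- the injection `ℕ × ℕ → ℤ × ℤ`
  set e : ℕ × ℕ ↪ ℤ × ℤ := ⟨fun p ↦ ((p.1 : ℤ), (p.2 : ℤ)), fun p q h ↦ by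
    simp only [Prod.mk.injEq, Nat.cast_inj] at h
    exact Prod.ext h.1 h.2⟩ with he
  have heoff : ∀ p ∈ I.offDiag, e p ∈ zstarOffDiag := by
    intro p hp
    rw [Finset.mem_offDiag] at hp
    have h1 := (hmemI p.1 hp.1).1
    have h2 := (hmemI p.2 hp.2.1).1
    refine ⟨?_, ?_, ?_⟩
    · simp only [he, Function.Embedding.coeFn_mk, ne_eq, Nat.cast_eq_zero]; omega
    · simp only [he, Function.Embedding.coeFn_mk, ne_eq, Nat.cast_eq_zero]; omega
    · simp only [he, Function.Embedding.coeFn_mk, ne_eq, Nat.cast_inj]; exact hp.2.2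
  -- termwise comparison
  have hterm : ∀ p ∈ I.offDiag, renormEnergy t p.1 p.2 ≤ 4 ^ 200 * G (e p) := by
    intro p hp
    rw [Finset.mem_offDiag] at hp
    obtain ⟨h1, h1'⟩ := hmemI p.1 hp.1
    obtain ⟨h2, h2'⟩ := hmemI p.2 hp.2.1
    have hE : renormEnergyZ t (p.1 : ℤ) (p.2 : ℤ) = renormEnergy t p.1 p.2 :=
      renormEnergyZ_natCast t (by omega) (by omega)
    have hEnn : 0 ≤ renormEnergy t p.1 p.2 := by
      rw [← hE]
      exact renormEnergyZ_nonneg_of_strictMono hmono (by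
        simp only [ne_eq, Nat.cast_inj]; exact hp.2.2)
    have hψ1 : (4 ^ 100 : ℝ)⁻¹ ≤ truncWeight T (p.1 : ℤ) :=
      truncWeight_ge_of_le hTlog (by
        rw [Int.cast_natCast, abs_of_nonneg (Nat.cast_nonneg _)]; exact h1')
    have hψ2 : (4 ^ 100 : ℝ)⁻¹ ≤ truncWeight T (p.2 : ℤ) :=
      truncWeight_ge_of_le hTlog (by
        rw [Int.cast_natCast, abs_of_nonneg (Nat.cast_nonneg _)]; exact h2')
    have hψψ : (4 ^ 100 : ℝ)⁻¹ * (4 ^ 100 : ℝ)⁻¹ ≤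
        truncWeight T (p.1 : ℤ) * truncWeight T (p.2 : ℤ) :=
      mul_le_mul hψ1 hψ2 (by positivity) (truncWeight_pos hTlog _).le
    have hGp : G (e p) = truncWeight T (p.1 : ℤ) * truncWeight T (p.2 : ℤ) *
        renormEnergy t p.1 p.2 := by
      simp only [hG, he, Function.Embedding.coeFn_mk, hE]
    rw [hGp]
    have h4 : (4 : ℝ) ^ 200 * ((4 ^ 100 : ℝ)⁻¹ * (4 ^ 100 : ℝ)⁻¹) = 1 := by norm_num
    calc renormEnergy t p.1 p.2
        = 4 ^ 200 * ((4 ^ 100 : ℝ)⁻¹ * (4 ^ 100 : ℝ)⁻¹) * renormEnergy t p.1 p.2 := by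
          rw [h4, one_mul]
      _ ≤ 4 ^ 200 * (truncWeight T (p.1 : ℤ) * truncWeight T (p.2 : ℤ)) *
          renormEnergy t p.1 p.2 := by
          apply mul_le_mul_of_nonneg_right _ hEnn
          exact mul_le_mul_of_nonneg_left hψψ (by positivity)
      _ = 4 ^ 200 * (truncWeight T (p.1 : ℤ) * truncWeight T (p.2 : ℤ) *
          renormEnergy t p.1 p.2) := by ring
  -- the finite sum against the series
  have hfin : ∑ p ∈ I.offDiag, G (e p) ≤ ∑' q : ℤ × ℤ, zstarOffDiag.indicator G q := by
    rw [← Finset.sum_map I.offDiag e G]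
    have hS : ∀ q ∈ I.offDiag.map e, q ∈ zstarOffDiag := by
      intro q hq
      rw [Finset.mem_map] at hq
      obtain ⟨p, hp, rfl⟩ := hq
      exact heoff p hp
    calc ∑ q ∈ I.offDiag.map e, G q
        = ∑ q ∈ I.offDiag.map e, zstarOffDiag.indicator G q :=
          Finset.sum_congr rfl fun q hq ↦ (Set.indicator_of_mem (hS q hq) G).symm
      _ ≤ ∑' q : ℤ × ℤ, zstarOffDiag.indicator G q :=
          hsumG.sum_le_tsum _ fun q _ ↦ Set.indicator_nonneg (fun q hq ↦ hGnn q hq) q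
  calc renormEnergyOn t I = ∑ p ∈ I.offDiag, renormEnergy t p.1 p.2 := renormEnergyOn_eq t I
    _ ≤ ∑ p ∈ I.offDiag, 4 ^ 200 * G (e p) := Finset.sum_le_sum hterm
    _ = 4 ^ 200 * ∑ p ∈ I.offDiag, G (e p) := by rw [Finset.mul_sum]
    _ ≤ 4 ^ 200 * ∑' q : ℤ × ℤ, zstarOffDiag.indicator G q :=
        mul_le_mul_of_nonneg_left hfin (by positivity)
    _ = 4 ^ 200 * truncEnergy T t := by rw [htsum]

end RodgersTaoIntegratedEnergyBound

/-! ## The schema and the as-printed reduction -/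

open RodgersTaoIntegratedEnergyBound in
/-- **Rodgers–Tao 2020, Theorem 17 from Proposition 22 and Corollary 25 — RH-free SCHEMA at a fixed
time `t₀ < 0` with `H_{t₀}` real-rooted** (the closing paragraph of §7, p. 56, and the reduction
(65) ⇐ (68), p. 42). The inner shapes (as typed in `RodgersTaoHamiltonian`) of Proposition 22
(`H̃_T` absolutely continuous on `[t₀/2, 0]`, `∂ₜH̃_T = −4Ẽ_T + o(T log³ T + Ẽ_T)` a.e., `Ẽ_T` finite
a.e.) and of Corollary 25 (`H̃_T(t) = O(δ T log³ T)` on `[t₀/4, 0]` for `δ → 0` slower than a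
threshold rate) imply the inner shape of Theorem 17 (`rodgers_tao_integrated_energy_bound`): for every
`ε > 0` and all large `T`, `t ↦ Ẽ^{[½T log T, 3T log T]}(t)` is integrable on `[t₀/4, 0]` and
`∫_{t₀/4}^0 Ẽ^{[½T log T, 3T log T]}(t) dt ≤ ε T log³ T`. Proof as printed: a.e.
`3 Ẽ_T ≤ −∂ₜH̃_T + ε' T log³ T` from (76), `Ẽ^{[…]} ≤ 4^{200} Ẽ_T` from (66), the fundamental theorem
of calculus `∫ ∂ₜH̃_T = H̃_T(0) − H̃_T(t₀/4)` for the absolutely continuous `H̃_T`, and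
`|H̃_T| = O(δ₁ T log³ T)` at both endpoints with `δ₁ → 0` the threshold rate of Corollary 25.
[cite: RodgersTaoFMP2020, Thm. 17 p. 42 and §7 p. 56 (= arXiv:1801.05914v4 Thm. 7.2)] -/
theorem rodgers_tao_integrated_energy_bound_of {t₀ : ℝ} (ht₀ : t₀ < 0)
    (hreal : HasOnlyRealZeros (deBruijnH t₀))
    (h22 : ∀ ε : ℝ, 0 < ε → ∃ T₁ : ℝ, ∀ T : ℝ, T₁ ≤ T →
      AbsolutelyContinuousOnInterval (truncHamiltonian T) (t₀ / 2) 0 ∧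
      ∀ᵐ t ∂(volume.restrict (Icc (t₀ / 2) 0)),
        Summable (truncEnergyTerm T t) ∧
        |deriv (truncHamiltonian T) t + 4 * truncEnergy T t| ≤
          ε * (T * Real.log T ^ 3 + truncEnergy T t))
    (h25 : ∃ δ₁ : ℝ → ℝ, (∀ T, 0 < δ₁ T) ∧ Tendsto δ₁ atTop (𝓝 0) ∧
      ∃ C : ℝ,
        ∀ δ : ℝ → ℝ, (∀ T, 0 < δ T) → Tendsto δ atTop (𝓝 0) → (∀ᶠ T in atTop, δ₁ T ≤ δ T) →
          ∃ T₁ : ℝ, ∀ T : ℝ, T₁ ≤ T → ∀ t : ℝ, t₀ / 4 ≤ t → t ≤ 0 →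
            |truncHamiltonian T t| ≤ C * (δ T * (T * Real.log T ^ 3))) :
    ∀ ε : ℝ, 0 < ε → ∃ T₀ : ℝ, ∀ T : ℝ, T₀ ≤ T →
      IntervalIntegrable
          (fun t ↦ renormEnergyOn t
            (Finset.Icc ⌈T * Real.log T / 2⌉₊ ⌊3 * T * Real.log T⌋₊))
          MeasureTheory.volume (t₀ / 4) 0 ∧
        ∫ t in (t₀ / 4)..0, renormEnergyOn t
            (Finset.Icc ⌈T * Real.log T / 2⌉₊ ⌊3 * T * Real.log T⌋₊) ≤
          ε * (T * Real.log T ^ 3) := by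
  intro ε hε
  obtain ⟨δ₁, hδ₁pos, hδ₁lim, C, H25⟩ := h25
  -- Corollary 25 with `δ := δ₁` itself
  obtain ⟨T₁, HT₁⟩ := H25 δ₁ hδ₁pos hδ₁lim (Eventually.of_forall fun _ ↦ le_rfl)
  -- constants: `c₀ := 4^200 / 3`, `A := c₀ · (−t₀/4)`, `B := c₀ · 2 · max C 0`
  obtain ⟨c₀, hc₀pos, hc₀⟩ : ∃ c₀ : ℝ, 0 < c₀ ∧ c₀ = 4 ^ 200 / 3 := ⟨_, by positivity, rfl⟩
  have ht₀ne : t₀ ≠ 0 := ht₀.ne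
  have hA : 0 < c₀ * (-t₀ / 4) := mul_pos hc₀pos (by linarith)
  have hAne : c₀ * (-t₀ / 4) ≠ 0 := hA.ne'
  -- the tolerance `ε'` fed to Proposition 22
  set ε' : ℝ := min 1 ((ε / 2) / (c₀ * (-t₀ / 4))) with hε'
  have hε'pos : 0 < ε' := lt_min one_pos (by positivity)
  have hε'1 : ε' ≤ 1 := min_le_left _ _
  have hε'A : c₀ * (-t₀ / 4) * ε' ≤ ε / 2 := by
    calc c₀ * (-t₀ / 4) * ε' ≤ c₀ * (-t₀ / 4) * ((ε / 2) / (c₀ * (-t₀ / 4))) :=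
          mul_le_mul_of_nonneg_left (min_le_right _ _) hA.le
      _ = ε / 2 := by field_simp
  obtain ⟨T₂, HT₂⟩ := h22 ε' hε'pos
  -- `δ₁(T)` small for large `T`
  have hη : 0 < (ε / 2) / (c₀ * 2 * max C 0 + 1) := by positivity
  obtain ⟨T₃, HT₃⟩ := Filter.eventually_atTop.1
    ((hδ₁lim.eventually (gt_mem_nhds hη)))
  refine ⟨max (max T₁ T₂) (max T₃ 3), fun T hT ↦ ?_⟩
  have hTT₁ : T₁ ≤ T := le_trans (le_trans (le_max_left _ _) (le_max_left _ _)) hT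
  have hTT₂ : T₂ ≤ T := le_trans (le_trans (le_max_right _ _) (le_max_left _ _)) hT
  have hTT₃ : T₃ ≤ T := le_trans (le_trans (le_max_left _ _) (le_max_right _ _)) hT
  have hT3 : 3 ≤ T := le_trans (le_trans (le_max_right _ _) (le_max_right _ _)) hT
  have hlog : 0 < Real.log T := Real.log_pos (by linarith)
  have hT0 : 0 < T := by linarith
  have hTlog : 0 < T * Real.log T := mul_pos hT0 hlog
  have hTL : 0 < T * Real.log T ^ 3 := by positivity
  obtain ⟨hAC, H22⟩ := HT₂ T hTT₂
  set I : Finset ℕ := Finset.Icc ⌈T * Real.log T / 2⌉₊ ⌊3 * T * Real.log T⌋₊ with hI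
  have h40 : t₀ / 4 ≤ 0 := by linarith
  -- absolute continuity and FTC on `[t₀/4, 0]`
  have hsub : uIcc (t₀ / 4) 0 ⊆ uIcc (t₀ / 2) 0 := by
    rw [uIcc_of_le h40, uIcc_of_le (by linarith : t₀ / 2 ≤ 0)]
    exact Icc_subset_Icc (by linarith) le_rfl
  have hAC' : AbsolutelyContinuousOnInterval (truncHamiltonian T) (t₀ / 4) 0 := hAC.mono hsub
  have hftc : ∫ s in (t₀ / 4)..0, deriv (truncHamiltonian T) s =
      truncHamiltonian T 0 - truncHamiltonian T (t₀ / 4) := hAC'.integral_deriv_eq_sub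
  have hint_deriv : IntervalIntegrable (deriv (truncHamiltonian T)) volume (t₀ / 4) 0 :=
    hAC'.intervalIntegrable_deriv
  -- integrability of the window energy (continuity in `t` above `t₀`)
  have hcont : ContinuousOn (fun s ↦ renormEnergyOn s I) (Icc (t₀ / 4) 0) :=
    (continuousOn_renormEnergyOn_Ioi hreal I).mono fun s hs ↦ by
      simp only [mem_Ioi]; linarith [hs.1]
  have hintE : IntervalIntegrable (fun s ↦ renormEnergyOn s I) volume (t₀ / 4) 0 :=
    hcont.intervalIntegrable_of_Icc h40
  refine ⟨hintE, ?_⟩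
  -- a.e. on `[t₀/4, 0]`: `Ẽ^I ≤ c₀ (ε' T log³ T − ∂ₜ H̃_T)`
  have hae : ∀ᵐ s ∂(volume.restrict (Icc (t₀ / 4) 0)),
      renormEnergyOn s I ≤ c₀ * (ε' * (T * Real.log T ^ 3) - deriv (truncHamiltonian T) s) := by
    have H22' : ∀ᵐ s ∂(volume.restrict (Icc (t₀ / 4) 0)),
        Summable (truncEnergyTerm T s) ∧
        |deriv (truncHamiltonian T) s + 4 * truncEnergy T s| ≤
          ε' * (T * Real.log T ^ 3 + truncEnergy T s) :=
      ae_restrict_of_ae_restrict_of_subset (Icc_subset_Icc (by linarith) le_rfl) H22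
    filter_upwards [H22', ae_restrict_mem measurableSet_Icc] with s hs hmem
    have hΛ : ∃ t₁ : ℝ, t₁ < s ∧ HasOnlyRealZeros (deBruijnH t₁) :=
      ⟨t₀, by linarith [hmem.1], hreal⟩
    have hE : 0 ≤ truncEnergy T s := truncEnergy_nonneg hTlog (strictMono_deBruijnZeroZ hΛ)
    have h1 := (abs_le.1 hs.2).2
    have h2 : ε' * truncEnergy T s ≤ 1 * truncEnergy T s :=
      mul_le_mul_of_nonneg_right hε'1 hE
    have h3 : renormEnergyOn s I ≤ 4 ^ 200 * truncEnergy T s :=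
      renormEnergyOn_le_truncEnergy hT3 hΛ hs.1
    have h4 : 3 * truncEnergy T s ≤
        ε' * (T * Real.log T ^ 3) - deriv (truncHamiltonian T) s := by nlinarith
    have h5 : c₀ * (3 * truncEnergy T s) ≤
        c₀ * (ε' * (T * Real.log T ^ 3) - deriv (truncHamiltonian T) s) :=
      mul_le_mul_of_nonneg_left h4 hc₀pos.le
    have h6 : c₀ * (3 * truncEnergy T s) = 4 ^ 200 * truncEnergy T s := by
      rw [hc₀]
      ring
    linarith
  -- integrate
  have hintR : IntervalIntegrable
      (fun s ↦ c₀ * (ε' * (T * Real.log T ^ 3) - deriv (truncHamiltonian T) s))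
      volume (t₀ / 4) 0 :=
    (intervalIntegrable_const.sub hint_deriv).const_mul c₀
  have hmono := intervalIntegral.integral_mono_ae_restrict h40 hintE hintR hae
  have hRHS : ∫ s in (t₀ / 4)..0,
      c₀ * (ε' * (T * Real.log T ^ 3) - deriv (truncHamiltonian T) s) =
      c₀ * (ε' * (T * Real.log T ^ 3) * (0 - t₀ / 4) -
        (truncHamiltonian T 0 - truncHamiltonian T (t₀ / 4))) := by
    rw [intervalIntegral.integral_const_mul, intervalIntegral.integral_sub
      intervalIntegrable_const hint_deriv, intervalIntegral.integral_const, smul_eq_mul, hftc]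
    ring
  rw [hRHS] at hmono
  -- Corollary 25 at the two endpoints
  have hb0 := HT₁ T hTT₁ 0 h40 le_rfl
  have hb4 := HT₁ T hTT₁ (t₀ / 4) le_rfl h40
  have hCmax : C * (δ₁ T * (T * Real.log T ^ 3)) ≤ max C 0 * (δ₁ T * (T * Real.log T ^ 3)) :=
    mul_le_mul_of_nonneg_right (le_max_left _ _) (mul_pos (hδ₁pos T) hTL).le
  have hH0 := (abs_le.1 (hb0.trans hCmax)).1
  have hH4 := (abs_le.1 (hb4.trans hCmax)).2
  -- `δ₁ T` is small
  have hδT : δ₁ T < (ε / 2) / (c₀ * 2 * max C 0 + 1) := HT₃ T hTT₃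
  have hδB : c₀ * 2 * max C 0 * δ₁ T ≤ ε / 2 := by
    have h1 : c₀ * 2 * max C 0 * δ₁ T ≤ (c₀ * 2 * max C 0 + 1) * δ₁ T :=
      mul_le_mul_of_nonneg_right (by linarith) (hδ₁pos T).le
    have h2 : (c₀ * 2 * max C 0 + 1) * δ₁ T ≤
        (c₀ * 2 * max C 0 + 1) * ((ε / 2) / (c₀ * 2 * max C 0 + 1)) :=
      mul_le_mul_of_nonneg_left hδT.le (by positivity)
    have hne : c₀ * 2 * max C 0 + 1 ≠ 0 := by positivity
    have h3 : (c₀ * 2 * max C 0 + 1) * ((ε / 2) / (c₀ * 2 * max C 0 + 1)) = ε / 2 := by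
      field_simp
    linarith
  -- conclusion
  have hfinal : c₀ * (ε' * (T * Real.log T ^ 3) * (0 - t₀ / 4) -
      (truncHamiltonian T 0 - truncHamiltonian T (t₀ / 4))) ≤ ε * (T * Real.log T ^ 3) := by
    have h1 : c₀ * (ε' * (T * Real.log T ^ 3) * (0 - t₀ / 4)) =
        (c₀ * (-t₀ / 4) * ε') * (T * Real.log T ^ 3) := by ring
    have h2 : c₀ * (-(truncHamiltonian T 0 - truncHamiltonian T (t₀ / 4))) ≤
        (c₀ * 2 * max C 0 * δ₁ T) * (T * Real.log T ^ 3) := by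
      have : -(truncHamiltonian T 0 - truncHamiltonian T (t₀ / 4)) ≤
          2 * (max C 0 * (δ₁ T * (T * Real.log T ^ 3))) := by linarith
      nlinarith
    have h3 : (c₀ * (-t₀ / 4) * ε') * (T * Real.log T ^ 3) ≤ (ε / 2) * (T * Real.log T ^ 3) :=
      mul_le_mul_of_nonneg_right hε'A hTL.le
    have h4 : (c₀ * 2 * max C 0 * δ₁ T) * (T * Real.log T ^ 3) ≤ (ε / 2) * (T * Real.log T ^ 3) :=
      mul_le_mul_of_nonneg_right hδB hTL.le
    nlinarith
  exact hmono.trans hfinal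

/-- **Rodgers–Tao 2020, Theorem 17 — AS-PRINTED reduction to Proposition 22 and Corollary 25
(RH-free, no use of `Λ ≥ 0`).** In their tree shapes: `rodgers_tao_truncHamiltonian_deriv` and
`rodgers_tao_truncHamiltonian_bound` imply `rodgers_tao_integrated_energy_bound` («the claim (68) now
follows from Corollary 25. This concludes the proof of Theorem 17»).
[cite: RodgersTaoFMP2020, Thm. 17 p. 42 and §7 p. 56 (= arXiv:1801.05914v4 Thm. 7.2)] -/
theorem rodgers_tao_integrated_energy_bound_of_facts
    (h22 : rodgers_tao_truncHamiltonian_deriv) (h25 : rodgers_tao_truncHamiltonian_bound) :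
    rodgers_tao_integrated_energy_bound :=
  fun t₀ ht₀ hreal ↦
    rodgers_tao_integrated_energy_bound_of ht₀ hreal (h22 t₀ ht₀ hreal) (h25 t₀ ht₀ hreal)

/-- **Rodgers–Tao 2020, Theorem 17 from Lemma 19, Proposition 22 and Lemma 24 (RH-free, no use of
`Λ ≥ 0`)**: the reduction `rodgers_tao_integrated_energy_bound_of_facts` composed with the as-printed
reduction of Corollary 25 to Lemma 19, Proposition 22 and Lemma 24
(`rodgers_tao_truncHamiltonian_bound_of_facts`). In tree shapes:
`rodgers_tao_truncHamiltonian_expansion → rodgers_tao_truncHamiltonian_deriv →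
rodgers_tao_truncEnergy_lower_bound → rodgers_tao_integrated_energy_bound`.
[cite: RodgersTaoFMP2020, Thm. 17 p. 42 and §7 pp. 54–56 (= arXiv:1801.05914v4 Thm. 7.2)] -/
theorem rodgers_tao_integrated_energy_bound_of_expansion_deriv_lowerBound
    (h19 : rodgers_tao_truncHamiltonian_expansion) (h22 : rodgers_tao_truncHamiltonian_deriv)
    (h24 : rodgers_tao_truncEnergy_lower_bound) : rodgers_tao_integrated_energy_bound :=
  rodgers_tao_integrated_energy_bound_of_facts h22
    (rodgers_tao_truncHamiltonian_bound_of_facts h19 h22 h24)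

/-- **Corollary 25 from Proposition 22 and Lemma 24 alone (RH-free)**: the Lemma 19 input of
`rodgers_tao_truncHamiltonian_bound_of_facts` is a content theorem of the tree
(`rodgers_tao_truncHamiltonian_expansion_of_cor33_location` with `RodgersTao2020.cor33_location_content`).
[cite: RodgersTaoFMP2020, Cor. 25 p. 56 (= arXiv:1801.05914v4 Cor. 7.10)] -/
theorem rodgers_tao_truncHamiltonian_bound_of_deriv_lowerBound
    (h22 : rodgers_tao_truncHamiltonian_deriv) (h24 : rodgers_tao_truncEnergy_lower_bound) :
    rodgers_tao_truncHamiltonian_bound :=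
  rodgers_tao_truncHamiltonian_bound_of_facts
    (rodgers_tao_truncHamiltonian_expansion_of_cor33_location RodgersTao2020.cor33_location_content)
    h22 h24

/-- **Theorem 17 from Proposition 22 and Lemma 24 alone (RH-free)**: in tree shapes,
`rodgers_tao_truncHamiltonian_deriv → rodgers_tao_truncEnergy_lower_bound →
rodgers_tao_integrated_energy_bound` (Lemma 19 discharged by the tree's content theorems, Corollary 25
by `rodgers_tao_truncHamiltonian_bound_of_deriv_lowerBound`).
[cite: RodgersTaoFMP2020, Thm. 17 p. 42 and §7 pp. 54–56 (= arXiv:1801.05914v4 Thm. 7.2)] -/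
theorem rodgers_tao_integrated_energy_bound_of_deriv_lowerBound
    (h22 : rodgers_tao_truncHamiltonian_deriv) (h24 : rodgers_tao_truncEnergy_lower_bound) :
    rodgers_tao_integrated_energy_bound :=
  rodgers_tao_integrated_energy_bound_of_facts h22
    (rodgers_tao_truncHamiltonian_bound_of_deriv_lowerBound h22 h24)

end Literature.NumberTheory.LFunctions

end
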